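import Summits.CriticalPhenomena.PercolationContinuityZ3.Theorems.PercNearOneGluingNoHeavyQuantFarLayerOneUnicyclic
import HarnessLib

/-!
# QUANT lane R8, front "FAR beyond trees" — layer one of FAR on a pendant forest on a cycle OBSERVED FROM A PENDANT TIP

builds on p205010 (kernel theorem, internal audit signed; external expert review pending)

Support file (`--supports stmt-CriticalPhenomena-4575`), seat `prim-quant-p1` (gen 18); memo
`run/shared/lean/prim/quant/prim-quant-p1-g18/FOR-LEAD-UNICYCLIC-TREES.md` §3 (iii)(b), `FOR-PROVERS-FLATTENING-FC.md` §1 (R3, first step).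
Standard axioms; no sorries; no definitions.

The first OFF-CYCLE observers: if the observer `o` is a tree vertex of a `PForest` WITHOUT CHILDREN whose parent is the cycle vertex `c_0` (e.g. the tip of a
hair of a sun, observing the other tips), the pendant-observer reduction `Bundle.layerOne_of_pendant_observer` moves the instance to `c_0`, where
`Bundle.layerOne_of_pforest_of_sunFAR` applies:
* `Quant.Bundle.layerOne_of_pforest_tip_of_sunFAR` — `2 < Σ_{a∈A} P(o ↔ a)` and `P(o ↮ a) ≤ t` on `A` imply `P(#{a ∈ A : o ↔ a} ≤ 1) ≤ t`, given
  `SunFAR K 1` for all `K ≥ 2`, for such an observer and every relay set `A ⊆ T ∪ cycle`.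
General tree observers (deeper stalks, subtrees below the observer) need the wrappers R2–R4 of the F-C note. [cite: KozmaNitzan2024, Conjecture 3 (p. 15)]; [this work].
-/

noncomputable section

namespace Summit.CriticalPhenomena.PercolationContinuityZ3.Theorems

namespace Quant

namespace Bundle

open Finset MeasureTheory Set
open Literature.Probability.LatticeModels
open Literature.Probability.Percolation
open Summit.CriticalPhenomena.PercolationContinuityZ3.Theorems.HairyCycle (SunFAR)
open scoped Classical

variable {n : ℕ} {L : ℕ} {cyc : ℕ → Fin n} {idx : Fin n → ℕ}

/-- **Layer one observed from a pendant tip of the cycle vertex `c_0`.**  For a pendant forest on a cycle, an observer `o ∈ T` with `par o = c_0` and no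
children, and relays `A ⊆ T ∪ cycle` (the case `o ∈ A` included): `2 < Σ_{a∈A} P(o ↔ a)` and `P(o ↮ a) ≤ t` on `A` imply `P(N_o ≤ 1) ≤ t`, given `SunFAR K 1`
for all `K ≥ 2`. [this work] -/
theorem layerOne_of_pforest_tip_of_sunFAR (hS : ∀ K, 2 ≤ K → SunFAR K 1) {T : Finset (Fin n)} {par : Fin n → Fin n} {dep : Fin n → ℕ}
    {w : Sym2 (Fin n) → unitInterval} (P : PForest L cyc idx T par dep w) {o : Fin n} (hoT : o ∈ T) (hpar : par o = cyc 0)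
    (hleaf : ∀ c ∈ T, par c ≠ o) (A : Finset (Fin n)) (hA : ∀ a ∈ A, a ∈ T ∨ ∃ i, i < L ∧ a = cyc i) (t : ℝ)
    (hEN : (2 : ℝ) < ∑ a ∈ A, (prodBernoulli w).real (openConn o a))
    (hcut : ∀ a ∈ A, (prodBernoulli w).real (openConn o a : Set (BondConfig (Fin n)))ᶜ ≤ t) :
    (prodBernoulli w).real {ω : BondConfig (Fin n) | (A.filter fun a => ω ∈ openConn o a).card ≤ 1} ≤ t := by
  by_cases hoA : o ∈ A
  · exact layerOne_of_observer_mem w A hoA t hEN hcut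
  have hL0 : 0 < L := by have := P.hL; omega
  have hoc : o ≠ cyc 0 := fun h => P.cyc_notMem 0 hL0 (h ▸ hoT)
  have hpend : ∀ x : Fin n, x ≠ o → x ≠ cyc 0 → w s(o, x) = 0 := by
    intro x hx hxc
    exact P.pendant_of_leaf hoT hleaf x hx (by rw [hpar]; exact hxc)
  exact layerOne_of_pendant_observer w hoc hpend A hoA
    (fun t' hmean' hcut' => layerOne_of_pforest_of_sunFAR hS P A hA t' hmean' hcut') t hEN hcut

end Bundle

end Quant

end Summit.CriticalPhenomena.PercolationContinuityZ3.Theorems
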